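import Summits.ResolutionOfSingularities.ResolutionOfSingularities.Theses.Valuative
import Summits.ResolutionOfSingularities.ResolutionOfSingularities.Theorems.ValuativeLuAlphaPTorsorDimTwo
import Summits.ResolutionOfSingularities.ResolutionOfSingularities.Theorems.ValuativeLuAlphaPTorsorAbhyankarPlace
import Summits.ResolutionOfSingularities.ResolutionOfSingularities.Theorems.ValuativeLuAlphaPTorsorClosedPointReduction
import Summits.ResolutionOfSingularities.ResolutionOfSingularities.Theorems.ValuativeLuAlphaPTorsorDiscreteAllDim
import Summits.ResolutionOfSingularities.ResolutionOfSingularities.Theorems.ValuativeLuAlphaPTorsorZeroDimReduction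
import Summits.ResolutionOfSingularities.ResolutionOfSingularities.Theorems.ValuativeLuAlphaPTorsorKnownRanges
import Summits.ResolutionOfSingularities.ResolutionOfSingularities.Theorems.ValuativeLuAlphaPTorsorAbhyankarTransfer
import Summits.ResolutionOfSingularities.ResolutionOfSingularities.Theorems.ValuativeLuAlphaPTorsorAbhyankarResidueExit
import Summits.ResolutionOfSingularities.ResolutionOfSingularities.Theorems.ValuativeLuAlphaPTorsorAbhyankarSepOfNotResidue
import Summits.ResolutionOfSingularities.ResolutionOfSingularities.Theorems.ValuativeLuAlphaPTorsorRankOne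
import Summits.ResolutionOfSingularities.ResolutionOfSingularities.Theorems.ValuativeLuAlphaPTorsorAdaptedDefs
import Summits.ResolutionOfSingularities.ResolutionOfSingularities.Theorems.ValuativeLuAlphaPTorsorAPFlagFinal
import Summits.ResolutionOfSingularities.ResolutionOfSingularities.Theorems.ValuativeLuAlphaPTorsorAdaptedValueStep
import Literature.AlgebraicGeometry.Resolution.CompositeValuations
import Literature.AlgebraicGeometry.Resolution.TranscendenceDefect
import Mathlib.Data.Matrix.Basic
import Mathlib.Algebra.Polynomial.AlgebraMap

/-!
# The crux `Valuative.LuAlphaPTorsor` is EQUIVALENT to its non-Abhyankar (defect) core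

Crux `Valuative.LuAlphaPTorsor` (item `stmt-ResolutionOfSingularities-0641`), line
`pfaff-line-log-final-forms`, lead seat c5 (2026-08-17). This file turns the line's whole
reduction (skeleton v6.4, ~35 000 landed lines under `Theorems/ValuativeLuAlphaPTorsor*.lean`)
into ONE importable theorem:

* `luAlphaPTorsor_of_nonAbhyankarCore` — the crux follows from its **non-Abhyankar core**: the
  same conclusion, but only for a valuation ring `O` which is ZERO-DIMENSIONAL over `k`
  (`κ(O)` algebraic over `k`), NOT an Abhyankar place of `K/k` (rational rank `< dim`: the
  valuations with room for defect), NOT discrete of rank one, at a CLOSED-POINT centre of the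
  regular base of dimension `≥ 3`, for a radicand `t ^ p` which is not a `p`-th power at the
  centre and none of whose `ℤ`-derivatives is a unit there;
* `luAlphaPTorsor_iff_nonAbhyankarCore` — and conversely (the core is an instance of the crux).

Everything else is PROVED in the tree and assembled here exactly as in the registered skeleton:
reduction to closed-point centres (`stub_closedPointReduction`) and zero-dimensional valuations
(`stub_zeroDimReduction`); the birational case (`stub_birationalExit`); Abhyankar places with
separably generated residue extension of `K` (`stub_abhyankarPlace`, Knaf–Kuhlmann 2005) or of
the base field `Frac A₀` (`stub_abhyankarTransfer`, `stub_abhyankarResidueExit`,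
`stub_abhyankarSepOfNotResidue`), or over a perfect ground field
(`luAlphaPTorsor_of_isAbhyankarPlace_of_perfectField`); base dimension `≤ 2` at the centre
(`luAlphaPTorsor_of_ringKrullDim_le_two`, Giraud 1983 along `ν`); a unit derivative of the
radicand (`luAlphaPTorsor_of_isUnit_derivation`); discrete rank-one valuations in every
dimension (`luAlphaPTorsor_of_discrete`); zero-dimensional Abhyankar places of rank one
(`stub_rankOneAbhyankar`, Frobenius twist + very good charts) and of rank `≥ 2`
(`abhyankarHigherRankCore_of_F6v` with `stub_adaptedValueStep`, flag-adapted charts).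

So the crux — relative local uniformization of `α_p`-torsors over regular bases, Temkin 2013
Rem. 1.3.5 — is EXACTLY local uniformization at the defect frontier: dimension `3` is of
Cossart–Piltant (2008/2009) strength, dimension `≥ 4` is
`Literature.Barriers.ResolutionOfSingularities.DimensionFourFrontier`. A planner can file the
core as its own statement item and close `stmt-0641` from it by
`luAlphaPTorsor_of_nonAbhyankarCore`.
-/

set_option linter.dupNamespace false

open IsLocalRing

namespace Summit.ResolutionOfSingularities.ResolutionOfSingularities.Theorems.PfaffLine

open Literature.AlgebraicGeometry.Resolution

/-- **The crux follows from its non-Abhyankar (defect) core.** If the conclusion of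
`Valuative.LuAlphaPTorsor` holds for every ZERO-DIMENSIONAL, NON-Abhyankar, non-discrete
valuation ring `O` at a closed-point centre of dimension `≥ 3` of the regular base, for radicands
`t ^ p` which are not `p`-th powers at the centre and have no unit `ℤ`-derivative there, then
`Valuative.LuAlphaPTorsor` holds. The proof is the composition of the line
`pfaff-line-log-final-forms` (all other cases are theorems of the tree, see the module
docstring). [new] -/
theorem luAlphaPTorsor_of_nonAbhyankarCore
    (H : ∀ p : ℕ, p.Prime → ∀ (k K : Type) [Field k] [CharP k p] [Field K] [Algebra k K] (O : ValuationSubring K) (A₀ : Subalgebra k K) (h₀ : A₀.toSubring ≤ O.toSubring) (t : K), A₀.FG → ∀ (htp : t ^ p ∈ A₀), IsFractionRing (Algebra.adjoin k (insert t (A₀ : Set K))) K → IsRegularLocalRing (Localization.AtPrime (Ideal.comap (Subring.inclusion h₀) (IsLocalRing.maximalIdeal O))) → (Ideal.comap (Subring.inclusion h₀) (IsLocalRing.maximalIdeal O)).IsMaximal → (∀ x : K, x ∈ O → ∃ f : Polynomial k, f ≠ 0 ∧ Polynomial.aeval x f ∈ O.nonunits) → ¬ ringKrullDim (Localization.AtPrime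 (Ideal.comap (Subring.inclusion h₀) (IsLocalRing.maximalIdeal O))) ≤ 2 → ¬ Literature.AlgebraicGeometry.Resolution.IsAbhyankarPlace O (algebraMap k K).fieldRange ⊤ → ¬ (∃ π : K, π ≠ 0 ∧ O.valuation π < 1 ∧ ∀ z : K, z ≠ 0 → ∃ n : ℤ, O.valuation z = O.valuation π ^ n) → (∀ δ : Derivation ℤ (Localization.AtPrime (Ideal.comap (Subring.inclusion h₀) (IsLocalRing.maximalIdeal O))) (Localization.AtPrime (Ideal.comap (Subring.inclusion h₀) (IsLocalRing.maximalIdeal O))), ¬ IsUnit (δ (algebraMap A₀.toSubring (Localization.AtPrime (Ideal.comap (Subring.inclusion h₀) (IsLocalRing.maximalIdeal O))) ⟨t ^ p, htp⟩))) → (∀ c : Localization.AtPrime (Ideal.comap (Subring.inclusion h₀) (IsLocalRing.maximalIdeal O)), algebraMap A₀.toSubring (Localization.AtPrime (Ideal.comap (Subring.inclusion h₀) (IsLocalRing.maximalIdeal O))) ⟨t ^ p, htp⟩ ≠ c ^ p) → ∃ (A : Subalgebra k K) (h : A.toSubring ≤ O.toSubring), A₀ ≤ A ∧ t ∈ A ∧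 A.FG ∧ IsFractionRing A K ∧ IsRegularLocalRing (Localization.AtPrime (Ideal.comap (Subring.inclusion h) (IsLocalRing.maximalIdeal O)))) :
    Summit.ResolutionOfSingularities.ResolutionOfSingularities.Theses.Valuative.LuAlphaPTorsor := by
  classical
  intro p hp
  -- reduction to closed-point centres (stub G) and zero-dimensional valuations (stub G₂)
  refine stub_closedPointReduction p hp ?_
  refine stub_zeroDimReduction p hp ?_
  intro k K _ _ _ _ O A₀ h₀ t hfg htp hfr hreg hmax hzd
  -- (0) the birational case
  by_cases hpow : ∃ c : Localization.AtPrime (Ideal.comap (Subring.inclusion h₀)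
      (IsLocalRing.maximalIdeal O)), algebraMap A₀.toSubring (Localization.AtPrime
        (Ideal.comap (Subring.inclusion h₀) (IsLocalRing.maximalIdeal O))) ⟨t ^ p, htp⟩ = c ^ p
  · exact stub_birationalExit p hp k K O A₀ h₀ t hfg htp hfr hreg hpow
  push Not at hpow
  -- (1) Abhyankar places with separably generated residue extension of `K`
  by_cases hAbh : Literature.AlgebraicGeometry.Resolution.IsAbhyankarPlace O (algebraMap k K).fieldRange ⊤ ∧
      Literature.AlgebraicGeometry.Resolution.SeparablyGeneratedOver
        (Literature.AlgebraicGeometry.Resolution.resField O (algebraMap k K).fieldRange)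
        (Literature.AlgebraicGeometry.Resolution.resField O ⊤)
  · exact stub_abhyankarPlace p hp k K O A₀ h₀ t hfg htp hfr hAbh.1 hAbh.2
  -- (1') Abhyankar places with separably generated residue extension of the base `K₀`
  by_cases hAbh₀ : Literature.AlgebraicGeometry.Resolution.IsAbhyankarPlace O (algebraMap k K).fieldRange ⊤ ∧
      Literature.AlgebraicGeometry.Resolution.SeparablyGeneratedOver
        (Literature.AlgebraicGeometry.Resolution.resField O (algebraMap k K).fieldRange)
        (Literature.AlgebraicGeometry.Resolution.resField O (Subfield.closure (A₀ : Set K)))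
  · obtain ⟨hAK, hS₀⟩ := hAbh₀
    have hA₀K : Literature.AlgebraicGeometry.Resolution.IsAbhyankarPlace O
        (algebraMap k K).fieldRange (Subfield.closure (A₀ : Set K)) :=
      stub_abhyankarTransfer p hp k K O A₀ h₀ t htp hfr hAK
    by_cases hPf : ∃ c g : K, c ∈ Subfield.closure (A₀ : Set K) ∧ g ∈ Subfield.closure (A₀ : Set K) ∧
        g ≠ 0 ∧ (t - c) / g ∈ O ∧
        ∀ z : K, z ∈ Subfield.closure (A₀ : Set K) → ¬ O.valuation ((t - c) / g - z) < 1
    · exact stub_abhyankarResidueExit p hp k K O A₀ h₀ t hfg htp hfr hA₀K hS₀ hPf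
    · exact stub_abhyankarPlace p hp k K O A₀ h₀ t hfg htp hfr hAK
        (stub_abhyankarSepOfNotResidue p hp k K O A₀ h₀ t hfg htp hfr hreg hAK hS₀ hPf hpow)
  -- (1'') Abhyankar places over a PERFECT ground field (KK05 Thm 1.1 + Cor 2.2, landed)
  by_cases hAbhP : Literature.AlgebraicGeometry.Resolution.IsAbhyankarPlace O (algebraMap k K).fieldRange ⊤ ∧
      PerfectField k
  · obtain ⟨hAK, hperf⟩ := hAbhP
    haveI := hperf
    exact luAlphaPTorsor_of_isAbhyankarPlace_of_perfectField p hp k K O A₀ h₀ t hfg htp hfr hAK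
  -- (2) base dimension ≤ 2 at the centre (Mon_ν(2), Giraud 1983 along ν)
  by_cases hdim2 : ringKrullDim (Localization.AtPrime (Ideal.comap (Subring.inclusion h₀)
      (IsLocalRing.maximalIdeal O))) ≤ 2
  · exact luAlphaPTorsor_of_ringKrullDim_le_two p hp k K O A₀ h₀ t hfg htp hfr hreg hdim2
  -- (3) a unit derivative
  by_cases hδ : ∃ δ : Derivation ℤ (Localization.AtPrime (Ideal.comap (Subring.inclusion h₀)
      (IsLocalRing.maximalIdeal O))) (Localization.AtPrime (Ideal.comap (Subring.inclusion h₀)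
      (IsLocalRing.maximalIdeal O))), IsUnit (δ (algebraMap A₀.toSubring (Localization.AtPrime
        (Ideal.comap (Subring.inclusion h₀) (IsLocalRing.maximalIdeal O))) ⟨t ^ p, htp⟩))
  · exact luAlphaPTorsor_of_isUnit_derivation p hp k K O A₀ h₀ t hfg htp hfr hreg hδ
  push Not at hδ
  -- (4) DISCRETE rank-one valuations, every dimension (branch DiscreteAllDim, landed)
  by_cases hdisc : ∃ π : K, π ≠ 0 ∧ O.valuation π < 1 ∧ ∀ z : K, z ≠ 0 → ∃ n : ℤ, O.valuation z = O.valuation π ^ n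
  · exact luAlphaPTorsor_of_discrete p hp k K O A₀ h₀ t hfg htp hfr hreg hdisc
  -- (5) zero-dimensional, closed-point centre of dimension ≥ 3, non-discrete:
  --     Abhyankar places — RANK ONE (S6, landed) / rank ≥ 2 (F⁶ᵇ, open) —, or the non-Abhyankar core (F⁶ᵃ, open)
  by_cases hAK : Literature.AlgebraicGeometry.Resolution.IsAbhyankarPlace O (algebraMap k K).fieldRange ⊤
  · by_cases hr1 : ∀ z w : K, O.valuation z < 1 → w ≠ 0 → ∃ N : ℕ, O.valuation z ^ N < O.valuation w
    · exact stub_rankOneAbhyankar p hp k K O A₀ h₀ t hfg htp hfr hzd hAK hr1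
    · exact abhyankarHigherRankCore_of_F6v stub_adaptedValueStep p hp k K O A₀ h₀ t hfg htp hfr hreg hmax hzd hdim2 hAK hr1
        (fun h => hAbh ⟨hAK, h⟩) (fun h => hAbh₀ ⟨hAK, h⟩) (fun h => hAbhP ⟨hAK, h⟩) hdisc hδ hpow
  · exact H p hp k K O A₀ h₀ t hfg htp hfr hreg hmax hzd hdim2 hAK hdisc hδ hpow

/-- **`Valuative.LuAlphaPTorsor` is equivalent to its non-Abhyankar (defect) core** (registered
anchor `luAlphaPTorsor_iff_nonAbhyankarCore` of item `stmt-ResolutionOfSingularities-0641`): the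
forward direction instantiates the crux, the backward one is `luAlphaPTorsor_of_nonAbhyankarCore`.
[new] -/
theorem luAlphaPTorsor_iff_nonAbhyankarCore :
    Summit.ResolutionOfSingularities.ResolutionOfSingularities.Theses.Valuative.LuAlphaPTorsor ↔
    (∀ p : ℕ, p.Prime → ∀ (k K : Type) [Field k] [CharP k p] [Field K] [Algebra k K] (O : ValuationSubring K) (A₀ : Subalgebra k K) (h₀ : A₀.toSubring ≤ O.toSubring) (t : K), A₀.FG → ∀ (htp : t ^ p ∈ A₀), IsFractionRing (Algebra.adjoin k (insert t (A₀ : Set K))) K → IsRegularLocalRing (Localization.AtPrime (Ideal.comap (Subring.inclusion h₀) (IsLocalRing.maximalIdeal O))) → (Ideal.comap (Subring.inclusion h₀) (IsLocalRing.maximalIdeal O)).IsMaximal → (∀ x : K, x ∈ O → ∃ f : Polynomial k, f ≠ 0 ∧ Polynomial.aeval x f ∈ O.nonunits) → ¬ ringKrullDim (Localization.AtPrime (Ideal.comap (Subring.inclusion h₀) (IsLocalRing.maximalIdeal O))) ≤ 2 → ¬ Literature.AlgebraicGeometry.Resolution.IsAbhyankarPlace O (algebraMap k K).fieldRange ⊤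 → ¬ (∃ π : K, π ≠ 0 ∧ O.valuation π < 1 ∧ ∀ z : K, z ≠ 0 → ∃ n : ℤ, O.valuation z = O.valuation π ^ n) → (∀ δ : Derivation ℤ (Localization.AtPrime (Ideal.comap (Subring.inclusion h₀) (IsLocalRing.maximalIdeal O))) (Localization.AtPrime (Ideal.comap (Subring.inclusion h₀) (IsLocalRing.maximalIdeal O))), ¬ IsUnit (δ (algebraMap A₀.toSubring (Localization.AtPrime (Ideal.comap (Subring.inclusion h₀) (IsLocalRing.maximalIdeal O))) ⟨t ^ p, htp⟩))) → (∀ c : Localization.AtPrime (Ideal.comap (Subring.inclusion h₀) (IsLocalRing.maximalIdeal O)), algebraMap A₀.toSubring (Localization.AtPrime (Ideal.comap (Subring.inclusion h₀) (IsLocalRing.maximalIdeal O))) ⟨t ^ p, htp⟩ ≠ c ^ p) → ∃ (A : Subalgebra k K) (h : A.toSubring ≤ O.toSubring), A₀ ≤ A ∧ t ∈ A ∧ A.FG ∧ IsFractionRing A K ∧ IsRegularLocalRing (Localization.AtPrime (Ideal.comap (Subring.inclusion h) (IsLocalRing.maximalIdeal O)))) := by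
  refine ⟨fun h => ?_, luAlphaPTorsor_of_nonAbhyankarCore⟩
  intro p hp k K _ _ _ _ O A₀ h₀ t hfg htp hfr hreg _ _ _ _ _ _ _
  exact h p hp k K O A₀ h₀ t hfg htp hfr hreg

end Summit.ResolutionOfSingularities.ResolutionOfSingularities.Theorems.PfaffLine
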